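import Summits.CriticalPhenomena.CardyFormulaZ2.Theorems.CardyComplexConeEdgePrecompactUFRSJunctionFunnelScaled
import Literature.Probability.Percolation.AnnulusCircuitsProofs

/-!
# The junction funnel, part B: the transition lemma and winding numbers off the fence
(line `qkz-strip-boundary-arm` of crux `CardyComplexCone.EdgePrecompact`, stmt-CriticalPhenomena-11387;
second file of the registered sub-goal S2 = `ufrs_junctionFunnel`, lead c5, wave 4; registered
anchor `fence_transition_JF`; continues `…UFRSJunctionFunnelScaled.lean`)

* `fence_transition_JF` — ONE STEP OF THE SUCCESSOR MAP DOES NOT CROSS THE FENCE except by entering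
  the gate corner. For a lattice walk `Φ` of the `×2`-scaled lattice (the fence) each of whose
  edges is (a) half of the scaled copy of a `β`-open edge, (b) one of the two link edges of the
  gate corner `c₀ = (v₀, k₀)`, (c) half of the scaled dual edge of a `β`-closed edge, or (d) has
  an endpoint outside the scaled closed box, and for a corner `c` whose face and whose
  successor's face are faces of the box with `nextCorner β c ≠ c₀`, the winding numbers
  `walkWinding Φ` around the scaled sample faces of `c` and of `nextCorner β c` agree: a rotation
  step crosses half of the closed target edge `cTgt c` (an edge of type (a) would make it open, of
  type (b) would make the successor `c₀`, types (c), (d) have the wrong parity / position), a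
  translation step crosses half of the dual edge of the open target edge (type (c) would make it
  closed, type (b) would make the successor `c₀`).
* `walkWinding_up_iter_JF`, `walkWinding_outer_JF`,
  `walkWinding_inner_JF` — the winding number vanishes above / right of / left of the shadow of
  the walk, is constant up a fence-free column, hence equals, inside the fence, its value on a
  row below the box.

References: H. Kesten, *Percolation theory for mathematicians* (1982), §2.2; G. Grimmett,
*Percolation* (1999), §11.2.
-/

set_option linter.unusedVariables false

namespace Summit.CriticalPhenomena.CardyFormulaZ2.Cruxes.EdgePrecompact.QkzStripBoundaryArm

open MeasureTheory Filter Set Metric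
open scoped Topology BigOperators Pointwise
open Literature.Probability.LatticeModels Literature.Probability.Percolation
open Literature.Probability.RandomPlanarGeometry (DobrushinDomain)
open Summit.CriticalPhenomena.CardyFormulaZ2.Theses.CardyComplexCone

noncomputable section
/-! ## The transition lemma: one step of the successor map does not change the winding number of
the fence around the sample face, unless the step enters the gate corner -/

/-- **Transition lemma of the funnel.** Let `Φ` be a lattice walk (the scaled fence) whose
endpoints lie strictly below the row `2J₀` and each of whose edges is (a) half of the scaled copy
of a `β`-OPEN edge, or (b) one of the two link edges `{2v₀, 2v₀ + u_{k₀}}`,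
`{2v₀ + u_{k₀}, 2v₀ + u_{k₀} + u_{k₀+1}}` of the gate corner `c₀ = (v₀, k₀)`, or (c) half of the
scaled dual edge of a `β`-CLOSED edge, or (d) has an endpoint outside the scaled closed box
`[2I₀, 2I₁] × [2J₀, 2J₁]`. Then for every corner `c` whose face and whose successor's face are
faces of the box `[I₀, I₁] × [J₀, J₁]`, and whose successor is not `c₀`, the winding numbers of
`Φ` around the scaled sample faces of `c` and of `nextCorner β c` agree: the step crosses half of
the target edge `cTgt c ∉ β` (rotation) or half of its dual edge, `cTgt c ∈ β` (translation),
which is none of (a)–(d). -/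
theorem fence_transition_JF : ∀ (β : BondConfig (Site 2)) (I₀ I₁ J₀ J₁ : ℤ) (v₀ : Site 2) (k₀ : Fin 4) (a b : Site 2) (Φ : (zdGraph 2).Walk a b), a 1 < 2 * J₀ → b 1 < 2 * J₀ → (∀ e ∈ Φ.edges, (∃ x y : Site 2, (zdGraph 2).Adj x y ∧ s(x, y) ∈ β ∧ e = s(x + x, x + y)) ∨ (e = s(v₀ + v₀, v₀ + v₀ + cornerUnit k₀) ∨ e = s(v₀ + v₀ + cornerUnit k₀, v₀ + v₀ + cornerUnit k₀ + cornerUnit (k₀ + 1))) ∨ (∃ f f' : Site 2, (zdGraph 2).Adj f f' ∧ sepEdge f f' ∉ β ∧ e = s(f + f + 1, f + f' + 1)) ∨ (∃ x ∈ e, ¬ (2 * I₀ ≤ x 0 ∧ x 0 ≤ 2 * I₁ ∧ 2 * J₀ ≤ x 1 ∧ x 1 ≤ 2 * J₁))) → ∀ (c : Site 2 × Fin 4), (I₀ ≤ cFace c 0 ∧ cFace c 0 + 1 ≤ I₁ ∧ J₀ ≤ cFace c 1 ∧ cFace c 1 + 1 ≤ J₁) → (I₀ ≤ cFace (nextCorner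 β c) 0 ∧ cFace (nextCorner β c) 0 + 1 ≤ I₁ ∧ J₀ ≤ cFace (nextCorner β c) 1 ∧ cFace (nextCorner β c) 1 + 1 ≤ J₁) → nextCorner β c ≠ (v₀, k₀) → walkWinding Φ ((nextCorner β c).1 + cFace (nextCorner β c)) = walkWinding Φ (c.1 + cFace c) := by
  intro β I₀ I₁ J₀ J₁ v₀ k₀ a b Φ ha hb hΦ c hc hc' hne
  obtain ⟨v, k⟩ := c
  have hray : ∀ (p : Site 2) (j : Fin 4), J₀ ≤ cFace (p, j) 1 → a ∉ rayAbove (p + cFace (p, j)) ∧ b ∉ rayAbove (p + cFace (p, j)) := by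
    intro p j hj
    have hcf : cFace (p, j) 1 = p 1 - cornerOff j 1 := by simp [cFace, faceAt]
    have hsq := sq_coord_JF p j 1
    have h01 := cornerOff_apply_zero_or_one j 1
    constructor <;> (intro hr; rw [mem_rayAbove] at hr; omega)
  obtain ⟨⟨a0, a1, a2, a3⟩, ⟨b0, b1, b2, b3⟩⟩ := vertex_coord_JF v k
  obtain ⟨c0, c1⟩ := centre_coord_JF v k
  simp only [Pi.add_apply] at c0 c1
  by_cases hmem : cTgt (v, k) ∈ β
  · -- translation step: crosses half of the dual edge of the target edge
    rw [nextCorner_of_mem hmem] at hc' hne ⊢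
    dsimp only at hc' hne ⊢
    symm
    refine walkWinding_eq_of_faceWalk Φ (SimpleGraph.Walk.cons (adj_sq_trans_JF v k) SimpleGraph.Walk.nil) ?_ ?_ ?_
    · intro dq hdq
      simp only [SimpleGraph.Walk.darts_cons, SimpleGraph.Walk.darts_nil, List.mem_cons, List.not_mem_nil,
        or_false] at hdq
      subst hdq
      show sepEdge (v + cFace (v, k)) (v + cornerUnit (k + 1) + cFace (v + cornerUnit (k + 1), k + 3)) ∉ Φ.edges
      rw [sepEdge_sq_trans_JF]
      intro hin
      rcases hΦ _ hin with ⟨x, y, hxy, hβ, he⟩ | (he | he) | ⟨f, f', hff', hβ, he⟩ | ⟨x, hx, hout⟩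
      · rw [sym2_eq_iff_coord_JF] at he
        simp only [Pi.add_apply] at he
        rw [adj_iff_coord_JF] at hxy
        rcases corner_coord_JF k with h | h | h | h <;> omega
      · rw [sym2_eq_iff_coord_JF] at he
        simp only [Pi.add_apply] at he
        rcases corner_coord_JF k with h | h | h | h <;> rcases corner_coord_JF k₀ with h' | h' | h' | h' <;> omega
      · rw [sym2_eq_iff_coord_JF] at he
        simp only [Pi.add_apply] at he
        rcases he with ⟨h1, h2, h3, h4⟩ | he
        · have hk : cornerUnit k = cornerUnit (k₀ + 1) := by rw [Site.eq_iff_two]; omega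
          have hk' : k = k₀ + 1 := cornerUnit_injective hk
          subst hk'
          apply hne
          have e3 : k₀ + 1 + 3 = k₀ := fin4_add_one_add_three k₀
          have e2 : cornerUnit (k₀ + 1 + 1) = -cornerUnit k₀ := by
            rw [show k₀ + 1 + 1 = k₀ + 2 by rw [add_assoc]; rfl]; exact cornerUnit_add_two k₀
          have e20 := congrFun e2 0
          have e21 := congrFun e2 1
          simp only [Pi.neg_apply] at e20 e21
          rw [Prod.mk.injEq, Site.eq_iff_two]
          simp only [Pi.add_apply]
          exact ⟨by omega, e3⟩
        · rcases corner_coord_JF k with h | h | h | h <;> rcases corner_coord_JF k₀ with h' | h' | h' | h' <;> omega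
      · rw [sym2_eq_iff_coord_JF] at he
        simp only [Pi.add_apply, Pi.one_apply] at he
        rcases he with ⟨h1, h2, h3, h4⟩ | ⟨h1, h2, h3, h4⟩
        · rcases corner_coord_JF k with h | h | h | h <;> omega
        · apply hβ
          have hs : sepEdge f f' = cTgt (v, k) := by
            refine sepEdge_eq_of_sum_JF hff' (adj_cTgt_JF v k) fun i => ?_
            fin_cases i <;> simp only [Pi.add_apply, Fin.zero_eta, Fin.mk_one, Fin.isValue] <;> omega
          rw [hs]; exact hmem
      · apply hout
        rw [sym2_mem_iff_coord_JF] at hx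
        simp only [Pi.add_apply] at hx
        omega
    · intro z hz
      simp only [SimpleGraph.Walk.support_cons, SimpleGraph.Walk.support_nil, List.mem_cons,
        List.not_mem_nil, or_false] at hz
      rcases hz with rfl | rfl
      · exact (hray v k hc.2.2.1).1
      · exact (hray _ _ hc'.2.2.1).1
    · intro z hz
      simp only [SimpleGraph.Walk.support_cons, SimpleGraph.Walk.support_nil, List.mem_cons,
        List.not_mem_nil, or_false] at hz
      rcases hz with rfl | rfl
      · exact (hray v k hc.2.2.1).2
      · exact (hray _ _ hc'.2.2.1).2
  · -- rotation step: crosses half of the target edge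
    rw [nextCorner_of_not_mem hmem] at hc' hne ⊢
    dsimp only at hc' hne ⊢
    symm
    refine walkWinding_eq_of_faceWalk Φ (SimpleGraph.Walk.cons (adj_sq_rot_JF v k) SimpleGraph.Walk.nil) ?_ ?_ ?_
    · intro dq hdq
      simp only [SimpleGraph.Walk.darts_cons, SimpleGraph.Walk.darts_nil, List.mem_cons, List.not_mem_nil,
        or_false] at hdq
      subst hdq
      show sepEdge (v + cFace (v, k)) (v + cFace (v, k + 1)) ∉ Φ.edges
      rw [sepEdge_sq_rot_JF]
      intro hin
      rcases hΦ _ hin with ⟨x, y, hxy, hβ, he⟩ | (he | he) | ⟨f, f', hff', hβ, he⟩ | ⟨x, hx, hout⟩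
      · rw [sym2_eq_iff_coord_JF] at he
        simp only [Pi.add_apply] at he
        rw [adj_iff_coord_JF] at hxy
        rcases he with ⟨h1, h2, h3, h4⟩ | he
        · apply hmem
          have hs : s(x, y) = cTgt (v, k) := by
            rw [show cTgt (v, k) = s(v, v + cornerUnit (k + 1)) from rfl, sym2_eq_iff_coord_JF]
            simp only [Pi.add_apply]
            omega
          rw [← hs]; exact hβ
        · rcases corner_coord_JF k with h | h | h | h <;> omega
      · rw [sym2_eq_iff_coord_JF] at he
        simp only [Pi.add_apply] at he
        rcases he with ⟨h1, h2, h3, h4⟩ | he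
        · have hk : cornerUnit (k + 1) = cornerUnit k₀ := by rw [Site.eq_iff_two]; omega
          have hk' : k + 1 = k₀ := cornerUnit_injective hk
          apply hne
          rw [Prod.mk.injEq, Site.eq_iff_two]
          exact ⟨by omega, hk'⟩
        · rcases corner_coord_JF k₀ with h' | h' | h' | h' <;> omega
      · rw [sym2_eq_iff_coord_JF] at he
        simp only [Pi.add_apply] at he
        rcases corner_coord_JF k₀ with h' | h' | h' | h' <;> omega
      · rw [sym2_eq_iff_coord_JF] at he
        simp only [Pi.add_apply, Pi.one_apply] at he
        rw [adj_iff_coord_JF] at hff'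
        rcases corner_coord_JF k with h | h | h | h <;> omega
      · apply hout
        rw [sym2_mem_iff_coord_JF] at hx
        simp only [Pi.add_apply] at hx
        have hcf0 : cFace (v, k + 1) 0 = v 0 - cornerOff (k + 1) 0 := by simp [cFace, faceAt]
        omega
    · intro z hz
      simp only [SimpleGraph.Walk.support_cons, SimpleGraph.Walk.support_nil, List.mem_cons,
        List.not_mem_nil, or_false] at hz
      rcases hz with rfl | rfl
      · exact (hray v k hc.2.2.1).1
      · exact (hray _ _ hc'.2.2.1).1
    · intro z hz
      simp only [SimpleGraph.Walk.support_cons, SimpleGraph.Walk.support_nil, List.mem_cons,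
        List.not_mem_nil, or_false] at hz
      rcases hz with rfl | rfl
      · exact (hray v k hc.2.2.1).2
      · exact (hray _ _ hc'.2.2.1).2

/-! ## Winding numbers far from the fence and along fence-free columns -/

/-- **Moving the base point up a fence-free column.** If no horizontal edge `{z, z + e₀}` with
`z₀ = u₀` and `u₁ < z₁ ≤ u₁ + n` is an edge of the walk `p`, and both endpoints of `p` lie at
height `≤ u₁`, then `p` winds equally around `u` and `u + n e₁`. -/
theorem walkWinding_up_iter_JF {a b : Site 2} (p : (zdGraph 2).Walk a b) (n : ℕ) : ∀ (u : Site 2),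
    a 1 ≤ u 1 → b 1 ≤ u 1 →
    (∀ z : Site 2, z 0 = u 0 → u 1 < z 1 → z 1 ≤ u 1 + n → s(z, z + Pi.single 0 1) ∉ p.edges) →
    walkWinding p u = walkWinding p (u + n • (Pi.single 1 1 : Site 2)) := by
  induction n with
  | zero => intro u _ _ _; simp
  | succ n ih =>
    intro u ha hb hz
    have step : walkWinding p u = walkWinding p (u + Pi.single 1 1) := by
      refine walkWinding_eq_walkWinding_up (hz _ (by simp) (by simp) (by simp)) ?_ ?_
      · intro hr; rw [mem_rayAbove] at hr; omega
      · intro hr; rw [mem_rayAbove] at hr; omega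
    rw [step, ih (u + Pi.single 1 1) (by simp; omega) (by simp; omega) ?_, succ_nsmul', add_assoc]
    intro z h0 h1 h2
    simp only [Pi.add_apply, single_one_apply_zero, add_zero, single_one_apply_one] at h0 h1 h2
    exact hz z h0 (by omega) (by push_cast; omega)

/-- **Outside the shadow of the fence the winding number vanishes.** If the walk `p` lies in
`[-(2M+2), 2M+1] × (-∞, 2M+1]` and ends below the row `2J₀`, then `p` does not wind around any
`u` at height `≥ 2J₀` which is above, to the right of, or (by a fence-free column up to the top)
to the left of this region. -/
theorem walkWinding_outer_JF {a b : Site 2} (p : (zdGraph 2).Walk a b) (J₀ M : ℤ) (ha : a 1 < 2 * J₀) (hb : b 1 < 2 * J₀)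
    (hsupp : ∀ z ∈ p.support, -(2 * M + 2) ≤ z 0 ∧ z 0 ≤ 2 * M + 1 ∧ z 1 ≤ 2 * M + 1)
    (u : Site 2) (hu : 2 * J₀ ≤ u 1) (hout : u 0 ≤ -(2 * M + 4) ∨ 2 * M + 1 ≤ u 0 ∨ 2 * M + 1 ≤ u 1) :
    walkWinding p u = 0 := by
  by_cases htop : 2 * M + 1 ≤ u 1
  · exact walkWinding_eq_zero_of_le (fun z hz => (hsupp z hz).2.2) htop
  rcases hout with hl | hr | ht
  · obtain ⟨n, hn⟩ : ∃ n : ℕ, (n : ℤ) = 2 * M + 1 - u 1 := ⟨(2 * M + 1 - u 1).toNat, by omega⟩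
    rw [walkWinding_up_iter_JF p n u (by omega) (by omega) ?_]
    · refine walkWinding_eq_zero_of_le (fun z hz => (hsupp z hz).2.2) ?_
      simp; omega
    · intro z h0 h1 h2 he
      have := (hsupp z (SimpleGraph.Walk.fst_mem_support_of_mem_edges p he)).1
      omega
  · exact walkWinding_eq_zero_of_right (fun z hz => (hsupp z hz).2.1) hr
  · exact absurd ht htop

/-- **Inside the fence the winding number is that of the row below the box.** If the horizontal
edges of `p` at height `≤ 4N - 2` all lie at abscissae `≥ 4N` or `≤ -4N`, then for `u` in the
column range `[-4N+1, 4N-2]` at height between `2J₀` and `4N - 2`, `p` winds around `u` as it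
winds around the point of the same column at height `2J₀ - 3` — where, by hypothesis, the
winding number is nonzero. -/
theorem walkWinding_inner_JF {a b : Site 2} (p : (zdGraph 2).Walk a b) (N I₀ I₁ J₀ : ℤ) (ha : a 1 ≤ 2 * J₀ - 3)
    (hb : b 1 ≤ 2 * J₀ - 3)
    (hΦ2 : ∀ z : Site 2, s(z, z + Pi.single 0 1) ∈ p.edges → z 1 ≤ 4 * N - 2 → 4 * N ≤ z 0 ∨ z 0 + 1 ≤ -(4 * N))
    (hbot : ∀ u : Site 2, u 1 = 2 * J₀ - 3 → -(4 * N) + 1 ≤ u 0 → u 0 ≤ 4 * N - 2 → 2 * I₀ ≤ u 0 → u 0 + 1 ≤ 2 * I₁ →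
      walkWinding p u ≠ 0)
    (u : Site 2) (hu0 : -(4 * N) + 1 ≤ u 0 ∧ u 0 ≤ 4 * N - 2) (hu0' : 2 * I₀ ≤ u 0 ∧ u 0 + 1 ≤ 2 * I₁)
    (hu1 : 2 * J₀ ≤ u 1 ∧ u 1 ≤ 4 * N - 2) :
    walkWinding p u ≠ 0 := by
  obtain ⟨n, hn⟩ : ∃ n : ℕ, (n : ℤ) = u 1 - (2 * J₀ - 3) := ⟨(u 1 - (2 * J₀ - 3)).toNat, by omega⟩
  set u' : Site 2 := u - n • (Pi.single 1 1 : Site 2) with hu'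
  have hu'0 : u' 0 = u 0 := by simp [hu']
  have hu'1 : u' 1 = u 1 - n := by simp [hu']
  have key := walkWinding_up_iter_JF p n u' (by omega) (by omega) ?_
  · have hu_eq : u' + n • (Pi.single 1 1 : Site 2) = u := by rw [hu', sub_add_cancel]
    rw [hu_eq] at key
    rw [← key]
    exact hbot u' (by omega) (by omega) (by omega) (by omega) (by omega)
  · intro z h0 h1 h2 he
    have := hΦ2 z he (by omega)
    omega

end

end Summit.CriticalPhenomena.CardyFormulaZ2.Cruxes.EdgePrecompact.QkzStripBoundaryArm
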